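import Literature.NumberTheory.LFunctions.Bettin2017OpenedKloosterman
import Literature.NumberTheory.LFunctions.KowalskiMichelPeterssonBoundWeilFree
import Mathlib.Analysis.SpecificLimits.Normed
import Mathlib.Analysis.PSeries
import HarnessLib

/-!
# The off-diagonal of Bettin 2017, Thm. 1.1 at prime level: exchange of sums, head `r ≤ R` by the
# opened Kloosterman sums, tail `r > R` by Weil's bound

Topic `Literature/NumberTheory/LFunctions` (cell landau-siegel / ls-inputs, input I2 =
`bettin2017_theorem11_primeLevel`, line `hecke_afe_petersson`, stub S4 `stub_offDiagonal`).

With `w_y(n) = n^{-1/2} e^{-2πny}` and Kowalski–Michel's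
`J(m,n) = petJ N m n = (2π/N) Σ_{r≥1} r⁻¹ S(m,n;Nr) J₁(4π√(mn)/(Nr))`, the off-diagonal term of the
twisted first moment is `E = Σ_n w_y(n) J(m,n)`. As in Bettin §2 (2.4)–(2.5) and §4: the double
series converges absolutely (Weil's bound — the tree's `norm_petKloostermanTerm_le_all`), so the
`n`- and `r`-sums may be exchanged (`tsum_weight_mul_petJ_eq`); each modulus `c = Nr` contributes at
most `r⁻¹ · 2π(3+2Λ(y))(1+log(Nr))√m` (`norm_tsum_besselWeight_mul_kloostermanSum_le`, the opened
Kloosterman sum) and at most `4πC√m N^{-1/2} (πy)⁻¹((πy)⁻¹+1) r^{-5/4}` (Weil termwise); using the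
first for `r ≤ R` and the second for `r > R` gives `norm_tsum_weight_mul_petJ_le`, valid for every
`R`. The choice of `R` and the final `≪ m^{1/2} N^{-1+ε}` are in the sequel file. Everything is
proved; no definition, no named fact.
-/

noncomputable section

open scoped Real
open Complex Finset Filter Topology
open Literature.Analysis.FunctionSpaces
open Literature.NumberTheory.LFunctions.KowalskiMichel2000

namespace Literature.NumberTheory.LFunctions.Bettin2017

/-! ### Elementary sums -/

/-- `Σ_n n e^{-2πny} ≤ (πy)⁻¹((πy)⁻¹ + 1)` for `y > 0` (`t e^{-t} ≤ 1` and the geometric series;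
`(1 − e^{−t})⁻¹ ≤ t⁻¹ + 1`). [folklore] -/
private theorem tsum_nat_mul_exp_le {y : ℝ} (hy : 0 < y) :
    Summable (fun n : ℕ ↦ (n : ℝ) * Real.exp (-(2 * π * n) * y)) ∧
      ∑' n : ℕ, (n : ℝ) * Real.exp (-(2 * π * n) * y) ≤ (π * y)⁻¹ * ((π * y)⁻¹ + 1) := by
  have hπy : 0 < π * y := by positivity
  set x := Real.exp (-(π * y)) with hx
  have hx0 : 0 < x := Real.exp_pos _
  have hx1 : x < 1 := by
    rw [hx, ← Real.exp_zero]; exact Real.exp_lt_exp.mpr (by linarith)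
  -- termwise: `n e^{-2πny} = (n e^{-πny}) e^{-πny} ≤ (πy)⁻¹ x^n`
  have hterm : ∀ n : ℕ, (n : ℝ) * Real.exp (-(2 * π * n) * y) ≤ (π * y)⁻¹ * x ^ n := by
    intro n
    have hsplit : Real.exp (-(2 * π * n) * y) = Real.exp (-(π * y * n)) * x ^ n := by
      rw [hx, ← Real.exp_nat_mul, ← Real.exp_add]; congr 1; ring
    have h1 : (π * y * n) * Real.exp (-(π * y * n)) ≤ 1 := by
      have h := Real.add_one_le_exp (π * y * n)
      have hpos : 0 < Real.exp (π * y * n) := Real.exp_pos _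
      have hprod : Real.exp (-(π * y * n)) * Real.exp (π * y * n) = 1 := by
        rw [← Real.exp_add]; simp
      nlinarith [Real.exp_pos (-(π * y * n))]
    rw [hsplit, ← mul_assoc]
    refine mul_le_mul_of_nonneg_right ?_ (pow_nonneg hx0.le n)
    rw [inv_eq_one_div, le_div_iff₀ hπy]
    calc (n : ℝ) * Real.exp (-(π * y * n)) * (π * y)
        = (π * y * n) * Real.exp (-(π * y * n)) := by ring
      _ ≤ 1 := h1
  have hgeom := hasSum_geometric_of_lt_one hx0.le hx1
  have hdom : Summable (fun n : ℕ ↦ (π * y)⁻¹ * x ^ n) := hgeom.summable.mul_left _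
  have hnonneg : ∀ n : ℕ, 0 ≤ (n : ℝ) * Real.exp (-(2 * π * n) * y) := fun n ↦ by positivity
  have hs : Summable (fun n : ℕ ↦ (n : ℝ) * Real.exp (-(2 * π * n) * y)) :=
    Summable.of_nonneg_of_le hnonneg hterm hdom
  refine ⟨hs, (hs.tsum_le_tsum hterm hdom).trans ?_⟩
  rw [tsum_mul_left, hgeom.tsum_eq]
  have h1x : 0 < 1 - x := by linarith
  -- `(1 - x)⁻¹ ≤ (πy)⁻¹ + 1` iff `1 ≤ (1 - x)((πy)⁻¹ + 1)`, from `(1 + t) e^{-t} ≤ 1`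
  have hkey : (1 - x)⁻¹ ≤ (π * y)⁻¹ + 1 := by
    rw [inv_le_iff_one_le_mul₀ h1x]
    have h := Real.add_one_le_exp (π * y)
    have hprod : x * Real.exp (π * y) = 1 := by rw [hx, ← Real.exp_add]; simp
    have hx' : x * (1 + π * y) ≤ 1 := by nlinarith
    have heq : ((π * y)⁻¹ + 1) * (1 - x) = 1 + (1 - x * (1 + π * y)) * (π * y)⁻¹ := by
      field_simp; ring
    rw [heq]
    have hnn : 0 ≤ (1 - x * (1 + π * y)) * (π * y)⁻¹ :=
      mul_nonneg (by linarith) (inv_pos.mpr hπy).le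
    linarith
  exact mul_le_mul_of_nonneg_left hkey (inv_pos.mpr hπy).le

/-- The `p`-series tail: `Σ_{r} (r + R + 1)^{-5/4} ≤ (R+1)^{-1/8} · Σ_r (r+1)^{-9/8}`. [folklore] -/
private theorem tsum_rpow_tail_le (R : ℕ) :
    Summable (fun r : ℕ ↦ (((r + (R + 1) : ℕ) : ℝ)) ^ (-(5 / 4 : ℝ))) ∧
    Summable (fun r : ℕ ↦ (((r + 1 : ℕ) : ℝ)) ^ (-(9 / 8 : ℝ))) ∧
      ∑' r : ℕ, (((r + (R + 1) : ℕ) : ℝ)) ^ (-(5 / 4 : ℝ)) ≤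
        (((R + 1 : ℕ) : ℝ)) ^ (-(1 / 8 : ℝ)) * ∑' r : ℕ, (((r + 1 : ℕ) : ℝ)) ^ (-(9 / 8 : ℝ)) := by
  have h54 : Summable (fun r : ℕ ↦ (r : ℝ) ^ (-(5 / 4 : ℝ))) :=
    Real.summable_nat_rpow.mpr (by norm_num)
  have h98 : Summable (fun r : ℕ ↦ (r : ℝ) ^ (-(9 / 8 : ℝ))) :=
    Real.summable_nat_rpow.mpr (by norm_num)
  have hs1 : Summable (fun r : ℕ ↦ (((r + (R + 1) : ℕ) : ℝ)) ^ (-(5 / 4 : ℝ))) :=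
    (summable_nat_add_iff (R + 1)).mpr h54
  have hs2 : Summable (fun r : ℕ ↦ (((r + 1 : ℕ) : ℝ)) ^ (-(9 / 8 : ℝ))) :=
    (summable_nat_add_iff 1).mpr h98
  refine ⟨hs1, hs2, ?_⟩
  rw [← tsum_mul_left]
  refine hs1.tsum_le_tsum (fun r ↦ ?_) (hs2.mul_left _)
  have hR1 : (0 : ℝ) < ((R + 1 : ℕ) : ℝ) := by positivity
  have hr1 : (0 : ℝ) < ((r + 1 : ℕ) : ℝ) := by positivity
  have hrR : (0 : ℝ) < ((r + (R + 1) : ℕ) : ℝ) := by positivity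
  have hsplit : (((r + (R + 1) : ℕ) : ℝ)) ^ (-(5 / 4 : ℝ)) =
      (((r + (R + 1) : ℕ) : ℝ)) ^ (-(1 / 8 : ℝ)) * (((r + (R + 1) : ℕ) : ℝ)) ^ (-(9 / 8 : ℝ)) := by
    rw [← Real.rpow_add hrR]; norm_num
  rw [hsplit]
  have h1 : ((R + 1 : ℕ) : ℝ) ≤ ((r + (R + 1) : ℕ) : ℝ) := by exact_mod_cast (by omega)
  have h2 : ((r + 1 : ℕ) : ℝ) ≤ ((r + (R + 1) : ℕ) : ℝ) := by exact_mod_cast (by omega)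
  exact mul_le_mul (Real.rpow_le_rpow_of_nonpos hR1 h1 (by norm_num))
    (Real.rpow_le_rpow_of_nonpos hr1 h2 (by norm_num)) (Real.rpow_nonneg hrR.le _)
    (Real.rpow_nonneg hR1.le _)

/-! ### The double series: termwise bound, absolute convergence, exchange -/

section Exchange

variable {N : ℕ} [NeZero N]

/-- **Weil's bound termwise against the weight**: for `N` prime, `m ≥ 1`, a divisor constant
`τ(r) ≤ C r^{1/4}`, and all `n, r`,
`‖w_y(n) · r⁻¹S(m,n;Nr)J₁(4π√(mn)/(Nr))‖ ≤ 4πC√m N^{-1/2} · (n e^{-2πny}) · r^{-5/4}`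
(`norm_petKloostermanTerm_le_all` with `√(m,n) ≤ √n`, `n^{-1/2}√n √n ≤ n`).
[cite: KowalskiMichel2000, §2.4.2 p. 312 (23)] -/
theorem norm_weight_mul_petKloostermanTerm_le (hN : N.Prime) {m : ℕ} (hm : 1 ≤ m) (y : ℝ)
    {C : ℝ} (hC : ∀ r : ℕ, ((r.divisors.card : ℕ) : ℝ) ≤ C * (r : ℝ) ^ (1 / 4 : ℝ)) (n r : ℕ) :
    ‖(((n : ℝ) ^ (-(1 / 2 : ℝ)) * Real.exp (-(2 * π * n) * y) : ℝ) : ℂ) *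
        petKloostermanTerm N m n r‖ ≤
      4 * π * C * Real.sqrt m * (N : ℝ) ^ (-(1 / 2 : ℝ)) *
        ((n : ℝ) * Real.exp (-(2 * π * n) * y)) * (r : ℝ) ^ (-(5 / 4 : ℝ)) := by
  have hC0 : 0 ≤ C := by have h := hC 1; simp at h; linarith
  rcases Nat.eq_zero_or_pos n with rfl | hn
  · simp only [Nat.cast_zero, Real.zero_rpow (show (-(1 / 2 : ℝ)) ≠ 0 by norm_num), zero_mul,
      Complex.ofReal_zero, norm_zero, mul_zero]
    exact le_refl _
  have hn0 : (0 : ℝ) < n := by exact_mod_cast hn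
  have hT := norm_petKloostermanTerm_le_all hN hm hC r (n := n)
  rw [norm_mul, Complex.norm_real, Real.norm_eq_abs, abs_of_nonneg (by positivity)]
  have hgcd : Real.sqrt ((m.gcd n : ℕ) : ℝ) ≤ Real.sqrt n :=
    Real.sqrt_le_sqrt (by exact_mod_cast Nat.le_of_dvd hn (Nat.gcd_dvd_right m n))
  have hsqn : Real.sqrt (n : ℝ) ≤ n := by
    rw [Real.sqrt_le_left (by positivity)]
    have hn1 : (1 : ℝ) ≤ n := by exact_mod_cast hn
    nlinarith
  have hu : (n : ℝ) ^ (-(1 / 2 : ℝ)) = (Real.sqrt n)⁻¹ := by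
    rw [Real.rpow_neg hn0.le, ← Real.sqrt_eq_rpow]
  have hsn : 0 < Real.sqrt n := Real.sqrt_pos.mpr hn0
  calc (n : ℝ) ^ (-(1 / 2 : ℝ)) * Real.exp (-(2 * π * n) * y) * ‖petKloostermanTerm N m n r‖
      ≤ (n : ℝ) ^ (-(1 / 2 : ℝ)) * Real.exp (-(2 * π * n) * y) *
          (4 * π * C * Real.sqrt n * Real.sqrt ((m : ℝ) * n) *
            (N : ℝ) ^ (-(1 / 2 : ℝ)) * (r : ℝ) ^ (-(5 / 4 : ℝ))) := by
        gcongr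
        exact hT.trans (by gcongr)
    _ = 4 * π * C * Real.sqrt m * (N : ℝ) ^ (-(1 / 2 : ℝ)) *
          (Real.sqrt n * Real.exp (-(2 * π * n) * y)) * (r : ℝ) ^ (-(5 / 4 : ℝ)) := by
        rw [hu, Real.sqrt_mul (Nat.cast_nonneg m)]
        have key : (Real.sqrt (n : ℝ))⁻¹ * Real.sqrt n = 1 := inv_mul_cancel₀ hsn.ne'
        calc (Real.sqrt (n : ℝ))⁻¹ * Real.exp (-(2 * π * n) * y) *
              (4 * π * C * Real.sqrt n * (Real.sqrt m * Real.sqrt n) *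
                (N : ℝ) ^ (-(1 / 2 : ℝ)) * (r : ℝ) ^ (-(5 / 4 : ℝ)))
            = 4 * π * C * Real.sqrt m * (N : ℝ) ^ (-(1 / 2 : ℝ)) *
                (((Real.sqrt (n : ℝ))⁻¹ * Real.sqrt n) * Real.sqrt n *
                  Real.exp (-(2 * π * n) * y)) * (r : ℝ) ^ (-(5 / 4 : ℝ)) := by ring
          _ = _ := by rw [key, one_mul]
    _ ≤ 4 * π * C * Real.sqrt m * (N : ℝ) ^ (-(1 / 2 : ℝ)) *
          ((n : ℝ) * Real.exp (-(2 * π * n) * y)) * (r : ℝ) ^ (-(5 / 4 : ℝ)) := by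
        gcongr

/-- **Absolute convergence of the double series** `Σ_{n,r} w_y(n) · r⁻¹S(m,n;Nr)J₁(4π√(mn)/(Nr))`
(`N` prime, `m ≥ 1`, `y > 0`). [cite: Bettin2017, §2 (2.4)–(2.5)] -/
theorem summable_weight_mul_petKloostermanTerm (hN : N.Prime) {m : ℕ} (hm : 1 ≤ m) {y : ℝ}
    (hy : 0 < y) :
    Summable (Function.uncurry fun (n r : ℕ) ↦
      (((n : ℝ) ^ (-(1 / 2 : ℝ)) * Real.exp (-(2 * π * n) * y) : ℝ) : ℂ) *
        petKloostermanTerm N m n r) := by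
  obtain ⟨C, -, hC⟩ :=
    Literature.NumberTheory.Sieve.exists_card_divisors_le_mul_rpow' (by norm_num : (0 : ℝ) < 1 / 4)
  obtain ⟨ha, -⟩ := tsum_nat_mul_exp_le hy
  have hb : Summable (fun r : ℕ ↦ (r : ℝ) ^ (-(5 / 4 : ℝ))) :=
    Real.summable_nat_rpow.mpr (by norm_num)
  have hprod := (ha.mul_of_nonneg hb (fun n ↦ by positivity)
    (fun r ↦ Real.rpow_nonneg (Nat.cast_nonneg r) _)).mul_left
    (4 * π * C * Real.sqrt m * (N : ℝ) ^ (-(1 / 2 : ℝ)))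
  refine Summable.of_norm_bounded hprod fun p ↦ ?_
  rcases p with ⟨n, r⟩
  simp only [Function.uncurry_apply_pair]
  have h := norm_weight_mul_petKloostermanTerm_le hN hm y hC n r
  linarith [h]

/-- **Exchange of the `n`- and `r`-sums** in the off-diagonal term:
`Σ_n w_y(n) J(m,n) = (2π/N) Σ_{r} Σ_n w_y(n) · r⁻¹S(m,n;Nr)J₁(4π√(mn)/(Nr))` (absolute convergence).
[cite: Bettin2017, §2 (2.4)–(2.5)] -/
theorem tsum_weight_mul_petJ_eq (hN : N.Prime) {m : ℕ} (hm : 1 ≤ m) {y : ℝ} (hy : 0 < y) :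
    ∑' n : ℕ, (((n : ℝ) ^ (-(1 / 2 : ℝ)) * Real.exp (-(2 * π * n) * y) : ℝ) : ℂ) * petJ N m n =
      2 * π / N * ∑' r : ℕ, ∑' n : ℕ,
        (((n : ℝ) ^ (-(1 / 2 : ℝ)) * Real.exp (-(2 * π * n) * y) : ℝ) : ℂ) *
          petKloostermanTerm N m n r := by
  have hsum := summable_weight_mul_petKloostermanTerm hN hm hy
  rw [hsum.tsum_comm, ← tsum_mul_left]
  refine tsum_congr fun n ↦ ?_
  rw [petJ_def, mul_left_comm, ← tsum_mul_left]

end Exchange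

/-! ### One modulus: the opened-Kloosterman bound (head) and the Weil bound (tail) -/

section Modulus

variable {N : ℕ} [NeZero N]

/-- **Head bound for one modulus** `c = Nr`, `r ≥ 1` (`N` prime, `m ≥ 1`, `y > 0`):
`‖Σ_n w_y(n) r⁻¹S(m,n;Nr)J₁(4π√(mn)/(Nr))‖ ≤ r⁻¹ · 2π(3+2Λ(y))(1+log(Nr))√m`
(`norm_tsum_besselWeight_mul_kloostermanSum_le`). [cite: Bettin2017, §4 (4.3) (case q = 1, α = 0)] -/
theorem norm_tsum_weight_mul_petKloostermanTerm_le_head (hN : N.Prime) {m : ℕ} (hm : 1 ≤ m)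
    {y : ℝ} (hy : 0 < y) {r : ℕ} (hr : 1 ≤ r) :
    ‖∑' n : ℕ, (((n : ℝ) ^ (-(1 / 2 : ℝ)) * Real.exp (-(2 * π * n) * y) : ℝ) : ℂ) *
        petKloostermanTerm N m n r‖ ≤
      (r : ℝ)⁻¹ * (2 * π * (3 + 2 * (-Real.log (1 - Real.exp (-(2 * π * y))))) *
        (1 + Real.log ((N : ℝ) * r)) * Real.sqrt m) := by
  have hr0 : r ≠ 0 := by omega
  haveI : NeZero (N * r) := ⟨mul_ne_zero hN.ne_zero hr0⟩
  have hc : 2 ≤ N * r := le_trans hN.two_le (Nat.le_mul_of_pos_right N (by omega))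
  have hcast : ((N * r : ℕ) : ℝ) = (N : ℝ) * r := by push_cast; ring
  have key := norm_tsum_besselWeight_mul_kloostermanSum_le (c := N * r) hc hm hy
  rw [hcast] at key
  have hterm : ∀ n : ℕ, (((n : ℝ) ^ (-(1 / 2 : ℝ)) * Real.exp (-(2 * π * n) * y) : ℝ) : ℂ) *
      petKloostermanTerm N m n r =
      (r : ℂ)⁻¹ * ((((n : ℝ) ^ (-(1 / 2 : ℝ)) * Real.exp (-(2 * π * n) * y) *
        besselJ 1 (4 * π * Real.sqrt ((m : ℝ) * n) / ((N : ℝ) * r)) : ℝ) : ℂ) *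
          kloostermanSum (N * r) (m : ZMod (N * r)) (n : ZMod (N * r))) := by
    intro n
    rw [petKloostermanTerm_of_ne_zero N m n hr0]
    push_cast
    ring
  rw [tsum_congr hterm, tsum_mul_left, norm_mul, norm_inv, Complex.norm_natCast]
  exact mul_le_mul_of_nonneg_left key (inv_nonneg.mpr (Nat.cast_nonneg r))

/-- **Tail bound for one modulus** (`N` prime, `m ≥ 1`, `y > 0`, any `r`):
`‖Σ_n w_y(n) r⁻¹S(m,n;Nr)J₁‖ ≤ 4πC√m N^{-1/2} (πy)⁻¹((πy)⁻¹+1) · r^{-5/4}` (Weil termwise).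
[cite: KowalskiMichel2000, §2.4.2 p. 312 (23)] -/
theorem norm_tsum_weight_mul_petKloostermanTerm_le_tail (hN : N.Prime) {m : ℕ} (hm : 1 ≤ m)
    {y : ℝ} (hy : 0 < y) {C : ℝ}
    (hC : ∀ r : ℕ, ((r.divisors.card : ℕ) : ℝ) ≤ C * (r : ℝ) ^ (1 / 4 : ℝ)) (r : ℕ) :
    ‖∑' n : ℕ, (((n : ℝ) ^ (-(1 / 2 : ℝ)) * Real.exp (-(2 * π * n) * y) : ℝ) : ℂ) *
        petKloostermanTerm N m n r‖ ≤
      4 * π * C * Real.sqrt m * (N : ℝ) ^ (-(1 / 2 : ℝ)) * ((π * y)⁻¹ * ((π * y)⁻¹ + 1)) *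
        (r : ℝ) ^ (-(5 / 4 : ℝ)) := by
  have hC0 : 0 ≤ C := by have h := hC 1; simp at h; linarith
  obtain ⟨ha, hale⟩ := tsum_nat_mul_exp_le hy
  set K := 4 * π * C * Real.sqrt m * (N : ℝ) ^ (-(1 / 2 : ℝ)) with hK
  have hK0 : 0 ≤ K := by rw [hK]; positivity
  have hb0 : 0 ≤ (r : ℝ) ^ (-(5 / 4 : ℝ)) := Real.rpow_nonneg (Nat.cast_nonneg r) _
  have hbound : ∀ n : ℕ, ‖(((n : ℝ) ^ (-(1 / 2 : ℝ)) * Real.exp (-(2 * π * n) * y) : ℝ) : ℂ) *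
      petKloostermanTerm N m n r‖ ≤
      K * (r : ℝ) ^ (-(5 / 4 : ℝ)) * ((n : ℝ) * Real.exp (-(2 * π * n) * y)) := by
    intro n
    have h := norm_weight_mul_petKloostermanTerm_le hN hm y hC n r
    rw [hK]; linarith [h]
  have hdom : Summable (fun n : ℕ ↦ K * (r : ℝ) ^ (-(5 / 4 : ℝ)) *
      ((n : ℝ) * Real.exp (-(2 * π * n) * y))) := ha.mul_left _
  calc ‖∑' n : ℕ, (((n : ℝ) ^ (-(1 / 2 : ℝ)) * Real.exp (-(2 * π * n) * y) : ℝ) : ℂ) *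
          petKloostermanTerm N m n r‖
      ≤ ∑' n : ℕ, K * (r : ℝ) ^ (-(5 / 4 : ℝ)) * ((n : ℝ) * Real.exp (-(2 * π * n) * y)) :=
        tsum_of_norm_bounded hdom.hasSum hbound
    _ = K * (r : ℝ) ^ (-(5 / 4 : ℝ)) * ∑' n : ℕ, (n : ℝ) * Real.exp (-(2 * π * n) * y) :=
        tsum_mul_left
    _ ≤ K * (r : ℝ) ^ (-(5 / 4 : ℝ)) * ((π * y)⁻¹ * ((π * y)⁻¹ + 1)) := by gcongr
    _ = K * ((π * y)⁻¹ * ((π * y)⁻¹ + 1)) * (r : ℝ) ^ (-(5 / 4 : ℝ)) := by ring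

end Modulus


/-! ### Head plus tail -/

section Split

variable {N : ℕ} [NeZero N]

/-- **The off-diagonal, split at `R`** (Bettin 2017, (2.4)–(2.5) with §4 for the head and Weil's
bound for the tail): for `N` prime, `m ≥ 1`, `y > 0`, a divisor constant `τ(r) ≤ C r^{1/4}` and
every `R`,
`‖Σ_n w_y(n) J(m,n)‖ ≤ (2π/N)·(2π(3+2Λ)(1+log(N(R+1)))(harmonic R)√m + 4πC√m N^{-1/2}(πy)⁻¹((πy)⁻¹+1)(R+1)^{-1/8} Z)`,
`Z = Σ_r (r+1)^{-9/8}`, `harmonic R = Σ_{r ≤ R} 1/r`. [cite: Bettin2017, §2 (2.4)–(2.5) and §4] -/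
theorem norm_tsum_weight_mul_petJ_le (hN : N.Prime) {m : ℕ} (hm : 1 ≤ m) {y : ℝ} (hy : 0 < y)
    {C : ℝ} (hC : ∀ r : ℕ, ((r.divisors.card : ℕ) : ℝ) ≤ C * (r : ℝ) ^ (1 / 4 : ℝ)) (R : ℕ) :
    ‖∑' n : ℕ, (((n : ℝ) ^ (-(1 / 2 : ℝ)) * Real.exp (-(2 * π * n) * y) : ℝ) : ℂ) * petJ N m n‖ ≤
      2 * π / N *
        (2 * π * (3 + 2 * (-Real.log (1 - Real.exp (-(2 * π * y))))) *
            (1 + Real.log ((N : ℝ) * (R + 1))) * Real.sqrt m * (∑ r ∈ range (R + 1), (r : ℝ)⁻¹) +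
          4 * π * C * Real.sqrt m * (N : ℝ) ^ (-(1 / 2 : ℝ)) * ((π * y)⁻¹ * ((π * y)⁻¹ + 1)) *
            ((((R + 1 : ℕ) : ℝ)) ^ (-(1 / 8 : ℝ)) *
              ∑' r : ℕ, (((r + 1 : ℕ) : ℝ)) ^ (-(9 / 8 : ℝ)))) := by
  have hN0 : (0 : ℝ) < N := by exact_mod_cast hN.pos
  have hC0 : 0 ≤ C := by have h := hC 1; simp at h; linarith
  set Λ := -Real.log (1 - Real.exp (-(2 * π * y))) with hΛ
  have hΛ0 : 0 ≤ Λ := by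
    rw [hΛ, neg_nonneg]
    have he0 : 0 < Real.exp (-(2 * π * y)) := Real.exp_pos _
    have he1 : Real.exp (-(2 * π * y)) < 1 := by
      rw [← Real.exp_zero]; exact Real.exp_lt_exp.mpr (by nlinarith [Real.pi_pos])
    exact Real.log_nonpos (by linarith) (by linarith)
  -- the inner sums `G r`
  set G : ℕ → ℂ := fun r ↦ ∑' n : ℕ,
    (((n : ℝ) ^ (-(1 / 2 : ℝ)) * Real.exp (-(2 * π * n) * y) : ℝ) : ℂ) *
      petKloostermanTerm N m n r with hG
  set K := 4 * π * C * Real.sqrt m * (N : ℝ) ^ (-(1 / 2 : ℝ)) * ((π * y)⁻¹ * ((π * y)⁻¹ + 1))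
    with hK
  have hK0 : 0 ≤ K := by rw [hK]; positivity
  have hGtail : ∀ r : ℕ, ‖G r‖ ≤ K * (r : ℝ) ^ (-(5 / 4 : ℝ)) := fun r ↦
    norm_tsum_weight_mul_petKloostermanTerm_le_tail hN hm hy hC r
  have hb : Summable (fun r : ℕ ↦ K * (r : ℝ) ^ (-(5 / 4 : ℝ))) :=
    (Real.summable_nat_rpow.mpr (by norm_num)).mul_left K
  have hGsum : Summable G := Summable.of_norm_bounded hb hGtail
  -- exchange and split
  rw [tsum_weight_mul_petJ_eq hN hm hy, norm_mul, ← hGsum.sum_add_tsum_nat_add (R + 1)]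
  have hnorm1 : ‖(2 * π / N : ℂ)‖ = 2 * π / N := by
    rw [show (2 * π / N : ℂ) = ((2 * π / N : ℝ) : ℂ) by push_cast; rfl, Complex.norm_real,
      Real.norm_of_nonneg (by positivity)]
  rw [hnorm1]
  refine mul_le_mul_of_nonneg_left ?_ (by positivity)
  -- head
  set A := 2 * π * (3 + 2 * Λ) * (1 + Real.log ((N : ℝ) * (R + 1))) * Real.sqrt m with hA
  have hlogNR : 0 ≤ Real.log ((N : ℝ) * (R + 1)) := by
    apply Real.log_nonneg
    have h1 : (1 : ℝ) ≤ N := by exact_mod_cast hN.one_lt.le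
    have h2 : (1 : ℝ) ≤ (R : ℝ) + 1 := by
      have : (0 : ℝ) ≤ R := Nat.cast_nonneg R
      linarith
    nlinarith
  have hA0 : 0 ≤ A := by rw [hA]; positivity
  have hGhead : ∀ r ∈ range (R + 1), ‖G r‖ ≤ A * (r : ℝ)⁻¹ := by
    intro r hr
    rcases Nat.eq_zero_or_pos r with rfl | hr1
    · have : G 0 = 0 := by
        simp only [hG, petKloostermanTerm_zero, mul_zero, tsum_zero]
      rw [this, norm_zero, Nat.cast_zero, inv_zero, mul_zero]
    · have h := norm_tsum_weight_mul_petKloostermanTerm_le_head hN hm hy (r := r) hr1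
      rw [← hΛ] at h
      refine h.trans ?_
      rw [mul_comm]
      refine mul_le_mul_of_nonneg_right ?_ (inv_nonneg.mpr (Nat.cast_nonneg r))
      rw [hA]
      have hrR : Real.log ((N : ℝ) * r) ≤ Real.log ((N : ℝ) * (R + 1)) := by
        have hr0 : (0 : ℝ) < r := by exact_mod_cast hr1
        apply Real.log_le_log (by positivity)
        have : (r : ℝ) ≤ R + 1 := by
          have := Finset.mem_range.mp hr
          exact_mod_cast (by omega)
        nlinarith
      gcongr
  have hhead : ‖∑ r ∈ range (R + 1), G r‖ ≤ A * ∑ r ∈ range (R + 1), (r : ℝ)⁻¹ := by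
    refine (norm_sum_le _ _).trans ?_
    rw [Finset.mul_sum]
    exact Finset.sum_le_sum hGhead
  -- tail
  obtain ⟨hs1, hs2, htail_le⟩ := tsum_rpow_tail_le R
  have hGshift : Summable (fun r : ℕ ↦ G (r + (R + 1))) := (summable_nat_add_iff (R + 1)).mpr hGsum
  have htail : ‖∑' r : ℕ, G (r + (R + 1))‖ ≤
      K * ((((R + 1 : ℕ) : ℝ)) ^ (-(1 / 8 : ℝ)) * ∑' r : ℕ, (((r + 1 : ℕ) : ℝ)) ^ (-(9 / 8 : ℝ))) := by
    calc ‖∑' r : ℕ, G (r + (R + 1))‖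
        ≤ ∑' r : ℕ, K * (((r + (R + 1) : ℕ) : ℝ)) ^ (-(5 / 4 : ℝ)) :=
          tsum_of_norm_bounded (hs1.mul_left K).hasSum fun r ↦ hGtail (r + (R + 1))
      _ = K * ∑' r : ℕ, (((r + (R + 1) : ℕ) : ℝ)) ^ (-(5 / 4 : ℝ)) := tsum_mul_left
      _ ≤ K * ((((R + 1 : ℕ) : ℝ)) ^ (-(1 / 8 : ℝ)) *
            ∑' r : ℕ, (((r + 1 : ℕ) : ℝ)) ^ (-(9 / 8 : ℝ))) :=
          mul_le_mul_of_nonneg_left htail_le hK0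
  calc ‖∑ r ∈ range (R + 1), G r + ∑' r : ℕ, G (r + (R + 1))‖
      ≤ ‖∑ r ∈ range (R + 1), G r‖ + ‖∑' r : ℕ, G (r + (R + 1))‖ := norm_add_le _ _
    _ ≤ A * ∑ r ∈ range (R + 1), (r : ℝ)⁻¹ +
          K * ((((R + 1 : ℕ) : ℝ)) ^ (-(1 / 8 : ℝ)) *
            ∑' r : ℕ, (((r + 1 : ℕ) : ℝ)) ^ (-(9 / 8 : ℝ))) := add_le_add hhead htail
    _ = _ := by rw [hA, hK]

end Split

end Literature.NumberTheory.LFunctions.Bettin2017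

end
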